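import Summits.BirchSwinnertonDyer.Rank1Residual.Additive.SubGordHigherOrdinary
import Summits.BirchSwinnertonDyer.Rank1Residual.Additive.TypeGRamification
import Literature.NumberTheory.EllipticCurves.MazurTorsionPrimeCaseFromCor44Proofs
import Mathlib.NumberTheory.RamificationInertia.Basic
import HarnessLib

/-!
# X3♯(G-ord) / X4♯(G-ord), defect `e ∈ {3,4,6}`: the semistability defect divides the ramification index — NO quadratic descent exists

HONEST FRAMING (cell `b2b-bsdres`, run/shared/lean/b2b/bsd-rank1-residual/, verbatim in every
file): the goal of the cell is to DELETE the COMBINATION-SHAPED residual classes of the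
Birch–Swinnerton-Dyer formula for ALL analytic-rank `≤ 1` elliptic curves over `ℚ` — "full BSD
formula for every rank `≤ 1` curve in class `C`" assembled STRICTLY from published theorems — so
that the rank-`≤ 1` remainder becomes exactly the CONSTRUCTION-SHAPED classes, which are TYPED
(missing-input `Prop`s), NOT attempted. This is not "finishing BSD". Sub-cell `additive-p2`
(CLASS-OWNERS row "X3/X4 additive — pot. good ordinary / X3♯(G-ord)"), generation 4: research
route; no claim beyond the stated classes; theorems only, no definition, no new named fact;
X3♯(G-ord)/X4♯(G-ord) stay CONSTRUCTION-SHAPED.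

WHAT THIS FILE DOES (the located gap of the base-change-and-descend route for `e ∈ {3,4,6}`, in
kernel form). Gen 0 proved that a field `F` over which `E` becomes semistable above an additive `p`
must RAMIFY at `p` (`UnramifiedBaseChange.lean`, `e(w|p) ≠ 1`). Here the sharp form:

* `twelve_dvd_ramificationIdx_mul_padicValRat_Δ_of_hasGoodReductionAt` — for ANY model `W/ℚ`, any
  number field `F`, any place `w ∣ p` of `F` at which `E_F` has good reduction:
  `12 ∣ e(w|p) · ord_p Δ(W)` (a `w`-minimal model has unit discriminant, `Δ_X = u⁻¹² Δ_W`, and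
  `ord_w = e(w|p) · ord_p` on `ℚ`; Silverman *AEC* VII.1.3, Mathlib `valuation_liesOver`).
* **`semistabilityIndex_dvd_ramificationIdx_of_hasGoodReductionAt`** — for `W` globally minimal:
  the census's semistability index `e_E(p) = 12 / gcd(12, ord_p Δ_min)` (additive-p4's
  `semistabilityIndex`; for `p ≥ 5` the order of the image of inertia, Serre–Tate / Kraus) DIVIDES
  the ramification index `e(w|p)` of every place `w ∣ p` of every number field `F` with `E_F` good
  at `w`.
* `not_hasMultiplicativeReductionAt_baseChange_of_padicValRat_j_nonneg` — with `ord_p j(E) ≥ 0`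
  (potentially good reduction, e.g. type (G): `padicValRat_j_nonneg_of_typeG`) `E_F` is never
  multiplicative above `p` (`ord_w j = e · ord_p j ≥ 0`, Silverman VII.5.1(b)); hence
  **`semistabilityIndex_dvd_ramificationIdx_of_isSemistableAt`**: `E_F` semistable at `w ∣ p` ⟹
  `e_E(p) ∣ e(w|p)`, and `semistabilityIndex_le_finrank_of_isSemistableAt`: `e_E(p) ≤ [F:ℚ]`
  (Mathlib `Ideal.ramificationIdx_le_finrank`).
* **`not_isSemistableAt_baseChange_quadratic_of_not_dvd_two`** — if `e_E(p) ∤ 2` (i.e.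
  `e ∈ {3,4,6,12}`; on the (G-ord) cell `e ∈ {3,4,6}` = additive-p4's `SubGordHigher`, Kodaira
  IV/IV*, III/III*, II/II*) then over EVERY quadratic field `K` the curve `E_K` is NOT semistable at
  any place above `p`; `not_isSemistableAt_baseChange_quadratic_of_subGordHigher` (`p ≥ 5`).

CONSEQUENCE for the route (HOME/b2b-bsdres-additive-p2/AUDIT-X34-GORD.md §4, row R2′): the
defect-2 relocation "BSD_p(E/ℚ) ⟺ p-part of BSD for `E_K`, `K = ℚ(√p*)`" (gens 2–4, via Milne's
`BSD(E/K) = BSD(E)·BSD(E^{(d_K)})`) has NO analogue on the `e ∈ {3,4,6}` cell (census: 599 X4 +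
33 X3 pairs, N < 2·10⁴): any semistabilising field has degree `≥ e(w|p) ≥ 3` over `ℚ`, over which
the BSD quotient of `E_F` factors through the twisted motives `h¹(E) ⊗ χ`, `χ ≠ 1, χ_K` — abelian
varieties, not elliptic curves over `ℚ` with a Covered row. So for `e ∈ {3,4,6}` TWO inputs are
unprinted: the `p`-part of BSD over `F` at a totally ramified `w ∣ p` with `e(w|p) ∈ {3,4,6}` (Wan
2015 / BCS 2025 need `p ∤ D_F`, gen 0) AND an equivariant (`χ`-isotypic) descent. Nothing is booked;
no label moves.

References: J. H. Silverman, *AEC* VII.1 Prop. 1.3, VII.5.1, VII.5.4; J.-P. Serre, J. Tate, Ann. of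
Math. 88 (1968) §2 Cor. 2–3; A. Kraus, Manuscripta Math. 69 (1990) 353–385 (the defect
`12/gcd(12, v(Δ))` for `p ≥ 5`); D. Delbourgo, Compositio Math. 113 (1998) §1.2 Lemma.
-/

noncomputable section

open scoped Classical NumberField

open WeierstrassCurve IsDedekindDomain IsDedekindDomain.HeightOneSpectrum NumberField
  Rat.HeightOneSpectrum Literature.NumberTheory.EllipticCurves
  Literature.NumberTheory.EllipticCurves.Rank1Residual

namespace Summit.BirchSwinnertonDyer.Rank1Residual.Additive

/-! ### Arithmetic of the semistability index -/

section Arithmetic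

variable (W : WeierstrassCurve ℚ) [W.IsGloballyMinimal] (p : ℕ)

/-- **`e ∣ n ⟺ 12 ∣ n · ord_p Δ_min`** for the semistability index `e = 12 / gcd(12, ord_p Δ_min)`
and any natural `n` (gen 2's `semistabilityIndex_dvd_iff` is the case `n = p − 1`): with
`g = gcd(12, v)`, `12 = e·g`, `v = (v/g)·g`, `gcd(e, v/g) = 1`. -/
theorem semistabilityIndex_dvd_iff_twelve_dvd_mul (n : ℕ) :
    semistabilityIndex W p ∣ n ↔ 12 ∣ n * padicValInt p W.minimalDiscriminantInt := by
  set v := padicValInt p W.minimalDiscriminantInt with hv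
  have hg12 : Nat.gcd 12 v ∣ 12 := Nat.gcd_dvd_left 12 v
  have hgv : Nat.gcd 12 v ∣ v := Nat.gcd_dvd_right 12 v
  have hgpos : 0 < Nat.gcd 12 v := Nat.gcd_pos_of_pos_left v (by norm_num)
  have he : semistabilityIndex W p * Nat.gcd 12 v = 12 := by
    show 12 / Nat.gcd 12 v * Nat.gcd 12 v = 12
    exact Nat.div_mul_cancel hg12
  have hvg : v / Nat.gcd 12 v * Nat.gcd 12 v = v := Nat.div_mul_cancel hgv
  constructor
  · intro h
    have h1 : 12 ∣ n * Nat.gcd 12 v := by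
      have h2 := Nat.mul_dvd_mul_right h (Nat.gcd 12 v)
      rwa [he] at h2
    exact dvd_trans h1 (Nat.mul_dvd_mul_left _ hgv)
  · intro h
    have hcop : Nat.Coprime (12 / Nat.gcd 12 v) (v / Nat.gcd 12 v) :=
      Nat.coprime_div_gcd_div_gcd hgpos
    have h1 : semistabilityIndex W p * Nat.gcd 12 v ∣ n * (v / Nat.gcd 12 v) * Nat.gcd 12 v := by
      rw [he, mul_assoc, hvg]; exact h
    have h2 : semistabilityIndex W p ∣ n * (v / Nat.gcd 12 v) :=
      Nat.dvd_of_mul_dvd_mul_right hgpos h1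
    exact hcop.dvd_of_dvd_mul_right h2

/-- `e ∣ 2 ⟺ 6 ∣ ord_p Δ_min` (`e ∈ {1, 2}`: good reduction or Kodaira `I₀*` at `p ≥ 5`). -/
theorem semistabilityIndex_dvd_two_iff :
    semistabilityIndex W p ∣ 2 ↔ 6 ∣ padicValInt p W.minimalDiscriminantInt := by
  rw [semistabilityIndex_dvd_iff_twelve_dvd_mul W p 2]
  omega

end Arithmetic

/-! ### Good reduction above `p` forces `e_E(p) ∣ e(w|p)` -/

section Ramification

variable (W : WeierstrassCurve ℚ) [W.IsElliptic] (p : ℕ) [hp : Fact p.Prime]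
  (F : Type) [Field F] [NumberField F] (w : HeightOneSpectrum (𝓞 F))

omit [NumberField F] in
/-- The prime of `ℤ` below a place `w ∋ p` of `F` is `(p)`: `w` lies over `Ideal.span {p}`. -/
theorem liesOver_span_of_natCast_mem (hw : (p : 𝓞 F) ∈ w.asIdeal) :
    w.asIdeal.LiesOver (Ideal.span {(p : ℤ)}) := by
  set v : HeightOneSpectrum ℤ := (Rat.HeightOneSpectrum.primesEquiv (R := ℤ)).symm ⟨p, hp.out⟩
    with hvdef
  have hv : Rat.HeightOneSpectrum.natGenerator v = p :=
    congrArg Subtype.val ((Rat.HeightOneSpectrum.primesEquiv (R := ℤ)).apply_symm_apply ⟨p, hp.out⟩)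
  have hvspan : v.asIdeal = Ideal.span {(p : ℤ)} := by
    rw [Rat.HeightOneSpectrum.asIdeal_eq_span_natGenerator_int, hv]
  have hunder : w.asIdeal.under ℤ = v.asIdeal := by
    have hle : v.asIdeal ≤ w.asIdeal.under ℤ := by
      rw [hvspan, Ideal.span_le, Set.singleton_subset_iff, SetLike.mem_coe, Ideal.under_def,
        Ideal.mem_comap, map_natCast]
      exact hw
    exact (v.isMaximal.eq_of_le (Ideal.IsPrime.ne_top inferInstance) hle).symm
  rw [← hvspan]
  exact ⟨hunder.symm⟩

/-- **Good reduction above `p` forces `12 ∣ e(w|p) · ord_p Δ(W)`** (any model `W/ℚ`, any number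
field `F`, any place `w ∋ p` of `F` with `E_F` good at `w`): a `w`-minimal model has `w`-unit
discriminant and differs from `W` by `u¹²` (`exists_valuation_Δ_eq_exp_twelve_mul_of_hasGoodReductionAt`),
while `ord_w(x) = e(w|p)·ord_p(x)` for `x ∈ ℚ` (Mathlib `valuation_liesOver`). Silverman *AEC*
VII.1 Prop. 1.3. (Gen 2's `twelve_dvd_of_typeG` is the special case `F ⊆ ℚ(ζ_p)`.) -/
theorem twelve_dvd_ramificationIdx_mul_padicValRat_Δ_of_hasGoodReductionAt
    (hw : (p : 𝓞 F) ∈ w.asIdeal) (hgood : (W.baseChange F).HasGoodReductionAt w) :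
    (12 : ℤ) ∣ ((Ideal.span {(p : ℤ)}).ramificationIdx' w.asIdeal : ℤ) * padicValRat p W.Δ := by
  haveI : (W.baseChange F).IsElliptic := by rw [baseChange]; infer_instance
  obtain ⟨m, hm⟩ :=
    exists_valuation_Δ_eq_exp_twelve_mul_of_hasGoodReductionAt (W.baseChange F) w hgood
  have hΔF : (W.baseChange F).Δ = algebraMap ℚ F W.Δ := by rw [baseChange, map_Δ]
  have hΔ0 : W.Δ ≠ 0 := W.isUnit_Δ.ne_zero
  -- the place of `ℤ` below `w` is `(p)`
  set v : HeightOneSpectrum ℤ := (Rat.HeightOneSpectrum.primesEquiv (R := ℤ)).symm ⟨p, hp.out⟩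
    with hvdef
  have hv : Rat.HeightOneSpectrum.natGenerator v = p :=
    congrArg Subtype.val ((Rat.HeightOneSpectrum.primesEquiv (R := ℤ)).apply_symm_apply ⟨p, hp.out⟩)
  have hvspan : v.asIdeal = Ideal.span {(p : ℤ)} := by
    rw [Rat.HeightOneSpectrum.asIdeal_eq_span_natGenerator_int, hv]
  haveI hlies' : w.asIdeal.LiesOver (Ideal.span {(p : ℤ)}) := liesOver_span_of_natCast_mem p F w hw
  haveI hlies : w.asIdeal.LiesOver v.asIdeal := by rw [hvspan]; exact hlies'
  -- `e(w|p)·ord_p Δ = −12 m`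
  have hval := valuation_liesOver (K := ℚ) (L := F) v w W.Δ
  rw [Rat.HeightOneSpectrum.valuation_eq_exp_neg_padicValRat v hΔ0, hv, ← hΔF, hm,
    ← WithZero.exp_nsmul, WithZero.exp_inj, nsmul_eq_mul] at hval
  rw [← hvspan]
  exact ⟨-m, by linear_combination (-1 : ℤ) * hval⟩

variable [W.IsGloballyMinimal]

/-- **The semistability defect divides the ramification index.** If `W/ℚ` is globally minimal and
`E_F` has GOOD reduction at a place `w ∋ p` of a number field `F`, then
`semistabilityIndex W p ∣ e(w|p)` (`e_E(p) = 12/gcd(12, ord_p Δ_min)`; for `p ≥ 5` this is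
Serre–Tate's statement that the inertia group acts through a cyclic group of order `e_E(p)` which a
semistabilising extension must kill; here it is pure valuation theory, valid at every `p`).
Silverman *AEC* VII.1.3 + `valuation_liesOver`. -/
theorem semistabilityIndex_dvd_ramificationIdx_of_hasGoodReductionAt
    (hw : (p : 𝓞 F) ∈ w.asIdeal) (hgood : (W.baseChange F).HasGoodReductionAt w) :
    semistabilityIndex W p ∣ (Ideal.span {(p : ℤ)}).ramificationIdx' w.asIdeal := by
  have h12 := twelve_dvd_ramificationIdx_mul_padicValRat_Δ_of_hasGoodReductionAt W p F w hw hgood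
  rw [padicValRat_Δ_eq W p] at h12
  rw [semistabilityIndex_dvd_iff_twelve_dvd_mul]
  exact_mod_cast h12

omit [W.IsGloballyMinimal] in
/-- **Potentially good reduction is never multiplicative upstairs**: if `ord_p j(E) ≥ 0` then for
every number field `F` and place `w ∋ p`, `E_F` is NOT multiplicative at `w` — multiplicative
reduction at `w` forces `w(j) > 1` (Silverman *AEC* VII.5.1(b),
`one_lt_valuation_j_of_hasMultiplicativeReduction_localMinimalModel`), but
`w(j) = v_p(j)^{e(w|p)} ≤ 1`. [cite: SilvermanAEC2009, Prop. VII.5.1(b)] -/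
theorem not_hasMultiplicativeReductionAt_baseChange_of_padicValRat_j_nonneg
    (hj : 0 ≤ padicValRat p W.j) (hw : (p : 𝓞 F) ∈ w.asIdeal) :
    ¬ (W.baseChange F).HasMultiplicativeReductionAt w := by
  intro hmult
  haveI : (W.baseChange F).IsElliptic := by rw [baseChange]; infer_instance
  have h1 := one_lt_valuation_j_of_hasMultiplicativeReduction_localMinimalModel w (W.baseChange F)
    hmult
  have hjF : (W.baseChange F).j = algebraMap ℚ F W.j := W.map_j (algebraMap ℚ F)
  rw [hjF] at h1
  -- the place of `ℤ` below `w`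
  set v : HeightOneSpectrum ℤ := (Rat.HeightOneSpectrum.primesEquiv (R := ℤ)).symm ⟨p, hp.out⟩
    with hvdef
  have hv : Rat.HeightOneSpectrum.natGenerator v = p :=
    congrArg Subtype.val ((Rat.HeightOneSpectrum.primesEquiv (R := ℤ)).apply_symm_apply ⟨p, hp.out⟩)
  have hvspan : v.asIdeal = Ideal.span {(p : ℤ)} := by
    rw [Rat.HeightOneSpectrum.asIdeal_eq_span_natGenerator_int, hv]
  haveI hlies' : w.asIdeal.LiesOver (Ideal.span {(p : ℤ)}) := liesOver_span_of_natCast_mem p F w hw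
  haveI hlies : w.asIdeal.LiesOver v.asIdeal := by rw [hvspan]; exact hlies'
  have hvj : v.valuation ℚ W.j ≤ 1 := by
    by_cases hj0 : W.j = 0
    · rw [hj0, map_zero]; exact zero_le
    rw [Rat.HeightOneSpectrum.valuation_eq_exp_neg_padicValRat v hj0, hv, ← WithZero.exp_zero,
      WithZero.exp_le_exp]
    linarith
  have hwj : w.valuation F (algebraMap ℚ F W.j) ≤ 1 := by
    rw [← valuation_liesOver (K := ℚ) (L := F) v w W.j]
    exact pow_le_one' hvj _
  exact absurd h1 (not_lt.mpr hwj)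

/-- **Semistable above a potentially-good `p` ⟹ good, with `e_E(p) ∣ e(w|p)`.** For `W/ℚ` globally
minimal with `ord_p j ≥ 0` and `E_F` semistable at `w ∋ p`: `E_F` is good at `w` and
`semistabilityIndex W p ∣ e(w|p)`. [cite: SilvermanAEC2009, Prop. VII.5.1(b)] -/
theorem semistabilityIndex_dvd_ramificationIdx_of_isSemistableAt (hj : 0 ≤ padicValRat p W.j)
    (hw : (p : 𝓞 F) ∈ w.asIdeal) (hss : (W.baseChange F).IsSemistableAt w) :
    (W.baseChange F).HasGoodReductionAt w ∧
      semistabilityIndex W p ∣ (Ideal.span {(p : ℤ)}).ramificationIdx' w.asIdeal := by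
  have hgood : (W.baseChange F).HasGoodReductionAt w :=
    hss.resolve_right (not_hasMultiplicativeReductionAt_baseChange_of_padicValRat_j_nonneg W p F w hj hw)
  exact ⟨hgood, semistabilityIndex_dvd_ramificationIdx_of_hasGoodReductionAt W p F w hw hgood⟩

/-- **A semistabilising field has degree at least the defect**: `ord_p j ≥ 0`, `E_F` semistable at
`w ∋ p` ⟹ `semistabilityIndex W p ≤ e(w|p) ≤ [F:ℚ]` (Mathlib `Ideal.ramificationIdx_le_finrank`).
[cite: SilvermanAEC2009, Prop. VII.5.1(b)] -/
theorem semistabilityIndex_le_finrank_of_isSemistableAt (hj : 0 ≤ padicValRat p W.j)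
    (hw : (p : 𝓞 F) ∈ w.asIdeal) (hss : (W.baseChange F).IsSemistableAt w) :
    semistabilityIndex W p ≤ Module.finrank ℚ F := by
  obtain ⟨-, hdvd⟩ := semistabilityIndex_dvd_ramificationIdx_of_isSemistableAt W p F w hj hw hss
  haveI := liesOver_span_of_natCast_mem p F w hw
  haveI : (Ideal.span {(p : ℤ)}).IsMaximal :=
    ((Ideal.span_singleton_prime (by exact_mod_cast hp.out.ne_zero)).mpr
      (Nat.prime_iff_prime_int.mp hp.out)).isMaximal (by
        rw [Ne, Ideal.span_singleton_eq_bot]; exact_mod_cast hp.out.ne_zero)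
  haveI := w.isPrime
  have hle : (Ideal.span {(p : ℤ)}).ramificationIdx' w.asIdeal ≤ Module.finrank ℚ F :=
    Ideal.ramificationIdx_le_finrank (𝓞 F) ℚ F w.asIdeal
  have hpos : 0 < (Ideal.span {(p : ℤ)}).ramificationIdx' w.asIdeal :=
    Nat.pos_of_ne_zero (Ideal.IsDedekindDomain.ramificationIdx'_ne_zero_of_liesOver w.asIdeal (by
      rw [Ne, Ideal.span_singleton_eq_bot]; exact_mod_cast hp.out.ne_zero))
  exact (Nat.le_of_dvd hpos hdvd).trans hle

end Ramification

/-! ### No quadratic field semistabilises a pair of defect `e ∈ {3, 4, 6}` -/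

section Quadratic

variable (W : WeierstrassCurve ℚ) [W.IsElliptic] [W.IsGloballyMinimal] (p : ℕ) [hp : Fact p.Prime]

/-- **No quadratic descent when `e ∤ 2`.** If `ord_p j(E) ≥ 0` and the semistability index of
`(E,p)` does not divide `2` (i.e. `e_E(p) ∈ {3, 4, 6, 12}`; at `p ≥ 5` on the (G-ord) cell:
Kodaira IV/IV*, III/III*, II/II*), then over EVERY quadratic field `K` and at EVERY place `w ∋ p`
the curve `E_K` is NOT semistable — `e_E(p) ∣ e(w|p) ≤ [K:ℚ] = 2` is impossible. In particular no
quadratic twist `E^{(d)}` is semistable at `p` and Milne's quadratic Weil-restriction identity has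
nothing to descend. [cite: SilvermanAEC2009, Prop. VII.5.1(b)] -/
theorem not_isSemistableAt_baseChange_quadratic_of_not_dvd_two (hj : 0 ≤ padicValRat p W.j)
    (he : ¬ semistabilityIndex W p ∣ 2) (K : Type) [Field K] [NumberField K]
    (h2 : Module.finrank ℚ K = 2) (w : HeightOneSpectrum (𝓞 K)) (hw : (p : 𝓞 K) ∈ w.asIdeal) :
    ¬ (W.baseChange K).IsSemistableAt w := by
  intro hss
  obtain ⟨-, hdvd⟩ := semistabilityIndex_dvd_ramificationIdx_of_isSemistableAt W p K w hj hw hss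
  have hle := semistabilityIndex_le_finrank_of_isSemistableAt W p K w hj hw hss
  rw [h2] at hle
  haveI := liesOver_span_of_natCast_mem p K w hw
  haveI := w.isPrime
  have hele : (Ideal.span {(p : ℤ)}).ramificationIdx' w.asIdeal ≤ 2 := by
    rw [← h2]
    haveI : (Ideal.span {(p : ℤ)}).IsMaximal :=
      ((Ideal.span_singleton_prime (by exact_mod_cast hp.out.ne_zero)).mpr
        (Nat.prime_iff_prime_int.mp hp.out)).isMaximal (by
          rw [Ne, Ideal.span_singleton_eq_bot]; exact_mod_cast hp.out.ne_zero)
    exact Ideal.ramificationIdx_le_finrank (𝓞 K) ℚ K w.asIdeal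
  have hpos : 0 < (Ideal.span {(p : ℤ)}).ramificationIdx' w.asIdeal :=
    Nat.pos_of_ne_zero (Ideal.IsDedekindDomain.ramificationIdx'_ne_zero_of_liesOver w.asIdeal (by
      rw [Ne, Ideal.span_singleton_eq_bot]; exact_mod_cast hp.out.ne_zero))
  -- `e_E ∣ e(w|p) ∈ {1, 2}` contradicts `e_E ∤ 2`
  interval_cases h : (Ideal.span {(p : ℤ)}).ramificationIdx' w.asIdeal
  · exact he (dvd_trans hdvd (by norm_num))
  · exact he hdvd

/-- On additive-p4's data cell `SubGordHigher` (`¬(ord_p j < 0)`, `f_p = 2`, `e ∣ p − 1`, `e ≠ 2`)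
at `p ≥ 5` the index is not `1` either (gen 3 `semistabilityIndex_ne_one_of_addv`, additive `p`),
so `e ∤ 2`. -/
theorem not_semistabilityIndex_dvd_two_of_subGordHigher (hp5 : 5 ≤ p) (hadd : Addv W p)
    (hS : SubGordHigher W p) : ¬ semistabilityIndex W p ∣ 2 := by
  obtain ⟨⟨hnot, -, -⟩, hne2⟩ := hS
  have hj : 0 ≤ padicValRat p W.j := not_lt.mp hnot
  have hne1 := semistabilityIndex_ne_one_of_addv W p hp5 hadd hj
  intro h
  have hle : semistabilityIndex W p ≤ 2 := Nat.le_of_dvd (by norm_num) h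
  interval_cases hsi : semistabilityIndex W p
  · -- `e = 0` is impossible: `e ∣ 12` with `e = 12 / gcd(12, v)`, `gcd ∣ 12`
    have h12 := semistabilityIndex_dvd_twelve W p
    rw [hsi] at h12
    norm_num at h12
  · exact hne1 rfl
  · exact hne2 rfl

/-- **X3♯/X4♯(G-ord), `e ∈ {3,4,6}`: no quadratic field semistabilises `E` above `p`** (`p ≥ 5`,
`Addv W p`, `SubGordHigher W p`): for every quadratic `K` and every `w ∋ p`, `E_K` is not
semistable at `w`. The twist-and-descend relocation of the defect-2 cell (`GordDescent*.lean`) has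
no instance here; a semistabilising `F` has `[F:ℚ] ≥ e(w|p) ≥ 3`
(`semistabilityIndex_le_finrank_of_isSemistableAt`). [cite: SilvermanAEC2009, Prop. VII.5.1(b)] -/
theorem not_isSemistableAt_baseChange_quadratic_of_subGordHigher (hp5 : 5 ≤ p) (hadd : Addv W p)
    (hS : SubGordHigher W p) (K : Type) [Field K] [NumberField K] (h2 : Module.finrank ℚ K = 2)
    (w : HeightOneSpectrum (𝓞 K)) (hw : (p : 𝓞 K) ∈ w.asIdeal) :
    ¬ (W.baseChange K).IsSemistableAt w :=
  not_isSemistableAt_baseChange_quadratic_of_not_dvd_two W p (not_lt.mp hS.1.1)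
    (not_semistabilityIndex_dvd_two_of_subGordHigher W p hp5 hadd hS) K h2 w hw

/-- **Degree bound on the (G-ord) cell with `e ∈ {3,4,6}`**: any number field `F` over which `E`
becomes semistable at some `w ∋ p` has `3 ≤ [F:ℚ]` (indeed `e_E(p) ≤ [F:ℚ]` with `e_E(p) ≥ 3`).
[cite: SilvermanAEC2009, Prop. VII.5.1(b)] -/
theorem three_le_finrank_of_isSemistableAt_of_subGordHigher (hp5 : 5 ≤ p) (hadd : Addv W p)
    (hS : SubGordHigher W p) (F : Type) [Field F] [NumberField F] (w : HeightOneSpectrum (𝓞 F))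
    (hw : (p : 𝓞 F) ∈ w.asIdeal) (hss : (W.baseChange F).IsSemistableAt w) :
    3 ≤ Module.finrank ℚ F := by
  have hj : 0 ≤ padicValRat p W.j := not_lt.mp hS.1.1
  have hle := semistabilityIndex_le_finrank_of_isSemistableAt W p F w hj hw hss
  have hnd := not_semistabilityIndex_dvd_two_of_subGordHigher W p hp5 hadd hS
  have h3 : 3 ≤ semistabilityIndex W p := by
    by_contra hlt
    rw [not_le] at hlt
    interval_cases hsi : semistabilityIndex W p
    · have h12 := semistabilityIndex_dvd_twelve W p
      rw [hsi] at h12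
      norm_num at h12
    · exact hnd (by norm_num)
    · exact hnd dvd_rfl
  exact h3.trans hle

end Quadratic

end Summit.BirchSwinnertonDyer.Rank1Residual.Additive

end
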